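/-
Copyright: cell gate-hubbard-kl, typer seat hubbard-kl-t9 (tranche-1 (b), facts-debt discharges). Theorem-only companion
of the FROZEN statement file `FermiRG/BGM2006AppA.lean` (F2c, 6f83e1e7d6ead567), which is not touched.
-/
import Literature.MathematicalPhysics.QuantumLattice.FermiRG.BGM2006AppA
import Literature.MathematicalPhysics.QuantumLattice.FermiRG.BGM2003SectorCountingProof
import Literature.MathematicalPhysics.QuantumLattice.SSectorNesting
import HarnessLib

/-!
# BGM 2006 Lemma A3.1 (Sector Counting Lemma) for a scale-independent dispersion relation, REDUCED to the
# proved BGM 2003 Lemma 3.1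

G. Benfatto, A. Giuliani, V. Mastropietro, *Fermi liquid behavior in the 2D Hubbard model at low temperatures*,
Ann. Henri Poincaré **7** (2006) 809–898 = arXiv:cond-mat/0507686, App. A3, Lemma A3.1 (render
`paper-arxiv-cond-mat_0507686` p0036:L144 – p0037:L2) [cite: BenfattoGiulianiMastropietro2006, Lemma A3.1]; and
G. Benfatto, A. Giuliani, V. Mastropietro, *Low temperature analysis of two-dimensional Fermi systems with symmetric
Fermi surface*, Ann. Henri Poincaré **4** (2003) 137–193 = arXiv:cond-mat/0207210, §3.1 Lemma 3.1 (4.3) and §7.4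
[cite: BenfattoGiulianiMastropietro2003, Lemma 3.1].

## What is proved here, and what is NOT

The licensed named fact F-011 of the `gate-hubbard-kl` wave is the PREDICATE
`BGM2006AppA.LemmaA31 γ e₀ μ eps c` (file `BGM2006AppA.lean`): for a scale-indexed family `eps : ℤ → (ℝ² → ℝ)` of
effective dispersion relations `ε_h` (BGM 2006 (2.36c); the intended instance is the INTERACTING family of Lemma 2.1),
the number of scale-`h'` anisotropic sector strings refining a given scale-`h` string and admitting momenta with signed
sum zero is `≤ c^L γ^{(h-h')(L-3)/2}`.  BGM print (App. A3, p0037:L3–9): *"the proof is an adaptation of the proof of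
the analogous Lemma of [BGM03] §7 … the only difference being that here the Fermi curve changes step by step by
`O(|U||h|γ^{2h})`"*.

THIS FILE proves the case in which the family does NOT change with the scale — `eps h = ε` for every `h`, `γ = 4` —
from the tree's PROVED `BGM2003.lemma31_sectorCounting_holds` (BGM 2003 Lemma 3.1 for an arbitrary smooth convex
centrally symmetric curve, hypotheses `BGM2003.DispersionHyp ε μ e₀ u`), under the one additional clause of BGM 2003
§1.2 item 1 that `BGM2003.DispersionHyp` does not carry (it only maps the polar chart INTO the level sets): the thin
shell `{|ε - μ| ≤ e₀}` IS the image of the polar chart `(θ,e) ↦ u(θ,e)e⃗_r(θ)` (hypothesis `hshell` below; print: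
"`ε(k⃗) - μ = e` is a regular convex closed curve `Σ(e) = {u(θ,e)e⃗_r(θ)}`", [BGM03] p0004:L97–103).

`theorem LemmaA31_of_scaleIndependent : DispersionHyp ε μ e₀ u → (shell = chart image) → ∃ c > 0,
LemmaA31 4 e₀ μ (fun _ ↦ ε) c`.

It is NOT `LemmaA31_holds` and F-011 STAYS a named fact: what F-011 asserts beyond this file is exactly the
UNIFORMITY of the BGM 2003 constant `c` along the interacting family `ε_h` of BGM 2006 Lemma 2.1 (the wave's gap
G-002: free curve vs. scale-dependent curve).  The three dictionary steps of the reduction are the content of this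
file and are each printed in BGM 2003 §7.4 / BGM 2006 App. A3:
* (signs) arbitrary charges `ε(f) ∈ {±}` reduce to all-`+` by the antipodal symmetry (2.8c)/(A1.4),
  `-S_{h,ω} = S_{h,ω+½|O_h|}` ([BGM03] p0028:L6–8 "momentum conservation and (2.8c)");
* (nesting) the index refinement `ω' ≺ ω` of BGM 2006 (2.69)/(2.88) implies the SET inclusion `S_{h',ω'} ⊆ S_{h,ω}` used
  in [BGM03] §7.4 (i) (the tree's `sectorWeightCirc_ne_zero_of_child`, iterated);
* (charts) a momentum `k⃗` with `|ε(k⃗) - μ| ≤ γ^h e₀` and `ζ_{h,ω}(θ(k⃗)) ≠ 0` (BGM 2006 (2.69), polar angle of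
  `k⃗`) is a chart point `u(θ,e)e⃗_r(θ)` with `|e| ≤ γ^h e₀`, `ζ_{h,ω}(θ) ≠ 0` (BGM 2003 (3.44a)).
Theorems only: no definition, no new named fact (D-0026); the half-turn index map and the signed momenta are written
out as `if`-terms.
-/

noncomputable section

open Real Set

namespace Literature.MathematicalPhysics.QuantumLattice.FermiRG

namespace BGM2006AppA

/-! ### §1 Angular partition: the half-turn shift and the polar angle of a ray point -/

/-- **Half-turn covariance of the line weights**: `ζ_{n,j+2ⁿ}(θ + π) = ζ_{n,j}(θ)` (the centre of `ζ_{n,j+2ⁿ}` is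
`θ_{n,j} + 2ⁿ·w_n = θ_{n,j} + π`). [cite: BenfattoGiulianiMastropietro2006, §2.5 (2.45)] -/
theorem sectorWeight_add_halfTurn (n : ℕ) (j : ℤ) (θ : ℝ) :
    sectorWeight n (j + 2 ^ n) (θ + π) = sectorWeight n j θ := by
  have hw : sectorWidth n = π / 2 ^ n := rfl
  have h2 : (0 : ℝ) < 2 ^ n := by positivity
  rw [sectorWeight, sectorWeight]
  congr 1
  rw [hw]
  push_cast
  field_simp
  ring

/-- **Half-turn covariance on the circle**: `ζ̃_{n,ω+2ⁿ}(θ + π) = ζ̃_{n,ω}(θ)`, i.e. the antipode of the sector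
`ω` is the sector `ω + ½|O_h|` (`|O_h| = 2^{n+1}`). [cite: BenfattoGiulianiMastropietro2006, §2.5 (2.45)] -/
theorem sectorWeightCirc_add_halfTurn (n : ℕ) (ω : ℤ) (θ : ℝ) :
    sectorWeightCirc n (ω + 2 ^ n) (θ + π) = sectorWeightCirc n ω θ := by
  unfold sectorWeightCirc
  refine tsum_congr fun k => ?_
  rw [show ω + 2 ^ n + k * (sectorCount n : ℤ) = (ω + k * sectorCount n) + 2 ^ n by ring]
  exact sectorWeight_add_halfTurn n _ θ

/-- The polar angle of a ray point: `θ(ρe⃗_r(θ)) = θ` for `ρ > 0`, `θ ∈ (-π, π]`. [folklore] -/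
private theorem polarAngle_smul_dir {ρ θ : ℝ} (hρ : 0 < ρ) (hθ : θ ∈ Ioc (-π) π) :
    polarAngle (ρ • dir θ) = θ := by
  unfold polarAngle
  have : momToComplex (ρ • dir θ) = ρ * (Complex.cos θ + Complex.sin θ * Complex.I) := by
    apply Complex.ext <;> simp [momToComplex, dir, Complex.cos_ofReal_re, Complex.sin_ofReal_re]
  rw [this]
  exact Complex.arg_mul_cos_add_sin_mul_I hρ hθ

/-- **The angular cutoff of a ray point**: `ζ̃_{n,ω}(θ(ρe⃗_r(θ))) = ζ̃_{n,ω}(θ)` for every `ρ > 0` and every real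
`θ` (both sides are `2π`-periodic in `θ`). [cite: BenfattoGiulianiMastropietro2006, §2.5 (2.45)–(2.46)] -/
theorem sectorWeightCirc_polarAngle_smul_dir (n : ℕ) (ω : ℤ) {ρ : ℝ} (hρ : 0 < ρ) (θ : ℝ) :
    sectorWeightCirc n ω (polarAngle (ρ • dir θ)) = sectorWeightCirc n ω θ := by
  -- reduce `θ` to its representative in `(-π, π]`
  set θ' : ℝ := toIocMod two_pi_pos (-π) θ with hθ'
  have hmem : θ' ∈ Ioc (-π) π := by
    have := toIocMod_mem_Ioc two_pi_pos (-π) θ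
    rwa [show -π + 2 * π = π by ring] at this
  have heq : θ' = θ - toIocDiv two_pi_pos (-π) θ • (2 * π) := (self_sub_toIocDiv_zsmul two_pi_pos (-π) θ).symm
  have hdir : dir θ' = dir θ := by
    rw [heq, zsmul_eq_mul, show θ - (toIocDiv two_pi_pos (-π) θ : ℝ) * (2 * π) =
      θ - 2 * π * (toIocDiv two_pi_pos (-π) θ : ℝ) by ring]
    exact dir_sub_two_pi_mul θ _
  rw [← hdir, polarAngle_smul_dir hρ hmem, heq]
  exact (periodic_sectorWeightCirc n ω).sub_zsmul_eq _

/-- The antipode of a ray direction: `-e⃗_r(θ) = e⃗_r(θ + π)`. [folklore] -/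
private theorem neg_dir_eq_dir_add_pi (θ : ℝ) : -dir θ = dir (θ + π) := by
  ext i
  fin_cases i <;> simp [dir, Real.cos_add_pi, Real.sin_add_pi]

/-! ### §2 BGM 2003 s-sectors: index periodicity, antipodes, nesting -/

/-- `S_{h,ω+|O_h|} = S_{h,ω}` (the circle weights are indexed modulo `|O_h| = 2^{n+1}`). [cite: BenfattoGiulianiMastropietro2003, §2.6 (3.44a)] -/
theorem sSector2003_add_sectorCount (u : ℝ → ℝ → ℝ) (e₀ : ℝ) (n : ℕ) (ω : ℤ) :
    BGM2003.sSector u e₀ n (ω + sectorCount n) = BGM2003.sSector u e₀ n ω := by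
  ext p
  simp only [BGM2003.sSector, mem_setOf_eq, sectorWeightCirc_add_sectorCount]

/-- `S_{h,ω-|O_h|} = S_{h,ω}`. [cite: BenfattoGiulianiMastropietro2003, §2.6 (3.44a)] -/
theorem sSector2003_sub_sectorCount (u : ℝ → ℝ → ℝ) (e₀ : ℝ) (n : ℕ) (ω : ℤ) :
    BGM2003.sSector u e₀ n (ω - sectorCount n) = BGM2003.sSector u e₀ n ω := by
  have := sSector2003_add_sectorCount u e₀ n (ω - sectorCount n)
  rw [sub_add_cancel] at this
  exact this.symm

/-- **Antipodes of s-sectors** under (A1.4) `u(θ+π,e) = u(θ,e)`: `p⃗ ∈ S_{h,ω} ⟹ -p⃗ ∈ S_{h,ω+2ⁿ}`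
(`2ⁿ = ½|O_h|`; [BGM03] §7.4 p0028:L6–8). [cite: BenfattoGiulianiMastropietro2003, §7.1 (A1.4) and §7.4] -/
theorem neg_mem_sSector2003 {u : ℝ → ℝ → ℝ} {e₀ : ℝ} (he₀ : 0 ≤ e₀)
    (hanti : ∀ θ e : ℝ, |e| ≤ e₀ → u (θ + π) e = u θ e) {n : ℕ} {ω : ℤ} {p : Fin 2 → ℝ}
    (hp : p ∈ BGM2003.sSector u e₀ n ω) : -p ∈ BGM2003.sSector u e₀ n (ω + 2 ^ n) := by
  obtain ⟨θ, e, he, hζ, rfl⟩ := hp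
  have he' : |e| ≤ e₀ := he.trans (mul_le_of_le_one_left he₀ (zpow_le_one_of_nonpos₀ (by norm_num) (by simp)))
  refine ⟨θ + π, e, he, ?_, ?_⟩
  · rwa [sectorWeightCirc_add_halfTurn]
  · rw [BGM2003.levelPoint, BGM2003.levelPoint, hanti θ e he', ← neg_dir_eq_dir_add_pi, smul_neg]

/-- One nesting step with natural indices: `S_{n+1,ω'} ⊆ S_{n,ω'/2}` ([BGM06] after (2.69): "`S_{h,2ω}` and `S_{h,2ω+1}`
are the two only sectors on scale `h` strictly contained into `S_{h+1,ω}`"). [cite: BenfattoGiulianiMastropietro2006, §2.7 (2.69) p0014:L75] -/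
theorem sSector2003_succ_subset (u : ℝ → ℝ → ℝ) {e₀ : ℝ} (he₀ : 0 ≤ e₀) (n : ℕ) (ω' : ℕ) :
    BGM2003.sSector u e₀ (n + 1) (ω' : ℤ) ⊆ BGM2003.sSector u e₀ n ((ω' / 2 : ℕ) : ℤ) := by
  have h4 : (4 : ℝ) ^ (-((n + 1 : ℕ) : ℤ)) ≤ (4 : ℝ) ^ (-(n : ℤ)) :=
    zpow_le_zpow_right₀ (by norm_num) (by push_cast; linarith)
  rintro p ⟨θ, e, he, hζ, rfl⟩
  refine ⟨θ, e, he.trans (mul_le_mul_of_nonneg_right h4 he₀), ?_, rfl⟩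
  rcases Nat.even_or_odd ω' with ⟨m, hm⟩ | ⟨m, hm⟩
  · have h1 : ((ω' : ℕ) : ℤ) = 2 * (((ω' / 2 : ℕ)) : ℤ) := by omega
    rw [h1] at hζ
    exact sectorWeightCirc_ne_zero_of_child (Or.inl hζ)
  · have h1 : ((ω' : ℕ) : ℤ) = 2 * (((ω' / 2 : ℕ)) : ℤ) + 1 := by omega
    rw [h1] at hζ
    exact sectorWeightCirc_ne_zero_of_child (Or.inr hζ)

/-- **Nesting across scales** ([BGM03] §7.4 (i), [BGM06] (2.88)): for `n ≤ n'`, `S_{n',ω'} ⊆ S_{n,ω'/2^{n'-n}}`.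
[cite: BenfattoGiulianiMastropietro2003, §7.4] -/
theorem sSector2003_subset_of_le (u : ℝ → ℝ → ℝ) {e₀ : ℝ} (he₀ : 0 ≤ e₀) {n n' : ℕ} (hn : n ≤ n') (ω' : ℕ) :
    BGM2003.sSector u e₀ n' (ω' : ℤ) ⊆ BGM2003.sSector u e₀ n ((ω' / 2 ^ (n' - n) : ℕ) : ℤ) := by
  obtain ⟨d, rfl⟩ := Nat.exists_eq_add_of_le hn
  rw [Nat.add_sub_cancel_left]
  clear hn
  induction d generalizing ω' with
  | zero => simp
  | succ d ih =>
    refine (sSector2003_succ_subset u he₀ (n + d) ω').trans ?_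
    have := ih (ω' / 2)
    rwa [Nat.div_div_eq_div_mul, ← pow_succ'] at this


/-! ### §3 The chart dictionary: BGM 2006 s-sectors of a scale-independent `ε` are BGM 2003 s-sectors -/

/-- For `h ≤ 0`, the tree index `n = -h` casts back: `((scaleIdx h : ℕ) : ℤ) = -h`. [folklore] -/
private theorem natCast_scaleIdx {h : ℤ} (hh : h ≤ 0) : ((scaleIdx h : ℕ) : ℤ) = -h := by
  rw [scaleIdx, Int.toNat_of_nonneg (by omega)]

/-- **(2.69) ⟹ (3.44a) for a scale-independent dispersion.**  Under the BGM 2003 §1.2 hypotheses on `(ε, μ, e₀, u)`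
and «the shell `|ε - μ| ≤ e₀` is the image of the polar chart» ([BGM03] §1.2 item 1), a momentum in the BGM 2006
anisotropic s-sector `S_{h,ω}` of the CONSTANT family `h ↦ ε` (`γ = 4`, `h ≤ 0`) lies in the BGM 2003 s-sector of
scale index `n = -h` and the same angular index. [cite: BenfattoGiulianiMastropietro2003, §2.6 (3.44a) p.13 (L101–106)] -/
theorem mem_sSector2003_of_mem_sSector {ε : (Fin 2 → ℝ) → ℝ} {μ e₀ : ℝ} {u : ℝ → ℝ → ℝ}
    (hε : BGM2003.DispersionHyp ε μ e₀ u)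
    (hshell : ∀ k : Fin 2 → ℝ, |ε k - μ| ≤ e₀ → ∃ θ e : ℝ, |e| ≤ e₀ ∧ k = BGM2003.levelPoint u θ e)
    {h : ℤ} (hh : h ≤ 0) {ω : ℕ} {k : Fin 2 → ℝ} (hk : k ∈ sSector 4 e₀ μ (fun _ => ε) h ω) :
    k ∈ BGM2003.sSector u e₀ (scaleIdx h) (ω : ℤ) := by
  obtain ⟨hk1, hk2⟩ := hk
  have h4 : (4 : ℝ) ^ h = (4 : ℝ) ^ (-((scaleIdx h : ℕ) : ℤ)) := by rw [natCast_scaleIdx hh, neg_neg]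
  have h4le : (4 : ℝ) ^ h ≤ 1 := zpow_le_one_of_nonpos₀ (by norm_num) hh
  have he₀ : 0 ≤ e₀ := hε.e₀_pos.le
  obtain ⟨θ, e, he, rfl⟩ := hshell k (hk1.trans (mul_le_of_le_one_left he₀ h4le))
  have hlev : ε (BGM2003.levelPoint u θ e) = μ + e := hε.level θ e he
  have he' : |e| ≤ (4 : ℝ) ^ (-((scaleIdx h : ℕ) : ℤ)) * e₀ := by
    have : e = ε (BGM2003.levelPoint u θ e) - μ := by rw [hlev]; ring
    rw [this, ← h4]; exact hk1
  obtain ⟨c, hc, hcu⟩ := hε.u_pos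
  have hupos : 0 < u θ e := hc.trans_le (hcu θ e he)
  refine ⟨θ, e, he', ?_, rfl⟩
  rwa [BGM2003.levelPoint, sectorWeightCirc_polarAngle_smul_dir _ _ hupos] at hk2

/-! ### §4 Sign normalisation of sector indices -/

/-! The HALF-TURN INDEX MAP.  The index of the sector carrying `±k⃗` when `k⃗ ∈ S_{h,j}` is `j` itself for the charge
`+` (`s = true`) and the antipodal index `j ± 2ⁿ ∈ [0, 2^{n+1})` for the charge `-` ([BGM03] §7.4 p.28 L6–8); it is
written out as the term `if s then j else if j < 2 ^ n then j + 2 ^ n else j - 2 ^ n` throughout (no definition is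
introduced). -/

/-- The half-turn index map preserves the index range `[0, |O_h|)`. [folklore] -/
private theorem halfTurnIdx_lt {n : ℕ} (s : Bool) {j : ℕ} (hj : j < sectorCount n) :
    (if s then j else if j < 2 ^ n then j + 2 ^ n else j - 2 ^ n) < sectorCount n := by
  unfold sectorCount at *
  rw [pow_succ] at *
  split_ifs <;> omega

/-- The half-turn index map is injective on `[0, |O_h|)` for each fixed charge. [folklore] -/
private theorem halfTurnIdx_injOn {n : ℕ} (s : Bool) {j j' : ℕ} (hj : j < sectorCount n) (hj' : j' < sectorCount n)
    (h : (if s then j else if j < 2 ^ n then j + 2 ^ n else j - 2 ^ n) =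
      (if s then j' else if j' < 2 ^ n then j' + 2 ^ n else j' - 2 ^ n)) : j = j' := by
  unfold sectorCount at *
  rw [pow_succ] at *
  split_ifs at h <;> omega

/-- **The half-turn index map commutes with the refinement map `ω' ↦ ω'/2^{n'-n}`** (the antipode of a child is a
child of the antipode). [folklore] -/
private theorem halfTurnIdx_div {n n' : ℕ} (hn : n ≤ n') (s : Bool) {j' : ℕ} (hj' : j' < sectorCount n') :
    (if s then j' else if j' < 2 ^ n' then j' + 2 ^ n' else j' - 2 ^ n') / 2 ^ (n' - n) =
      (if s then j' / 2 ^ (n' - n) else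
        if j' / 2 ^ (n' - n) < 2 ^ n then j' / 2 ^ (n' - n) + 2 ^ n else j' / 2 ^ (n' - n) - 2 ^ n) := by
  obtain ⟨d, rfl⟩ := Nat.exists_eq_add_of_le hn
  rw [Nat.add_sub_cancel_left]
  cases s
  · simp only [Bool.false_eq_true, ↓reduceIte]
    have hD : 0 < 2 ^ d := by positivity
    have hpow : 2 ^ (n + d) = 2 ^ n * 2 ^ d := pow_add 2 n d
    rw [sectorCount, pow_succ, hpow] at hj'
    by_cases hlt : j' < 2 ^ (n + d)
    · rw [if_pos hlt]
      have h1 : j' / 2 ^ d < 2 ^ n := by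
        rw [Nat.div_lt_iff_lt_mul hD]; rwa [hpow] at hlt
      rw [if_pos h1, hpow, Nat.add_mul_div_right _ _ hD]
    · rw [if_neg hlt]
      push Not at hlt
      have h1 : ¬ j' / 2 ^ d < 2 ^ n := by
        rw [not_lt, Nat.le_div_iff_mul_le hD]; rwa [hpow] at hlt
      rw [if_neg h1, hpow, mul_comm]
      exact Nat.sub_mul_div j' (2 ^ d) (2 ^ n)
  · simp

/-- **Signs out**: if `k⃗ ∈ S_{h,j}` then the signed momentum `ε k⃗` ((2.84a): `ε(f)k⃗(f)`, `ε ∈ {±}`) lies in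
`S_{h,j}` for `ε = +` and in the antipodal sector (half-turn index) for `ε = -`, by (A1.4).
[cite: BenfattoGiulianiMastropietro2003, §7.4 p.28 (L6–8)] -/
theorem signedMom_mem_sSector2003 {u : ℝ → ℝ → ℝ} {e₀ : ℝ} (he₀ : 0 ≤ e₀)
    (hanti : ∀ θ e : ℝ, |e| ≤ e₀ → u (θ + π) e = u θ e) {n : ℕ} (s : Bool) {j : ℕ} {k : Fin 2 → ℝ}
    (hk : k ∈ BGM2003.sSector u e₀ n (j : ℤ)) :
    (if s then k else -k) ∈
      BGM2003.sSector u e₀ n (((if s then j else if j < 2 ^ n then j + 2 ^ n else j - 2 ^ n : ℕ)) : ℤ) := by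
  cases s
  · simp only [Bool.false_eq_true, ↓reduceIte]
    have hneg := neg_mem_sSector2003 he₀ hanti hk
    split_ifs with hlt
    · push_cast; exact hneg
    · push Not at hlt
      have hcast : (((j - 2 ^ n : ℕ)) : ℤ) = ((j : ℤ) + 2 ^ n) - sectorCount n := by
        rw [sectorCount, pow_succ]; push_cast [hlt]; ring
      rw [hcast, sSector2003_sub_sectorCount]
      exact hneg
  · simpa using hk

/-! ### §5 The reduction -/

/-- **BGM 2006 Lemma A3.1 for a scale-independent dispersion relation, from BGM 2003 Lemma 3.1 (PROVED in the tree,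
`BGM2003.lemma31_sectorCounting_holds`).**  Let `(ε, μ, e₀, u)` satisfy the BGM 2003 §1.2 hypotheses
`BGM2003.DispersionHyp` (smooth, convex, centrally symmetric level curves `Σ(e) = {u(θ,e)e⃗_r(θ)}`, `|e| ≤ e₀`) and let
the shell `{|ε - μ| ≤ e₀}` be the image of the polar chart ([BGM03] §1.2 item 1).  Then there is `c > 0` such that the
Sector Counting Lemma A3.1 of BGM 2006 holds with `γ = 4` for the CONSTANT family `h ↦ ε`: for all `h' ≤ h ≤ 0`,
`L = m + 1 ≥ 4`, every charge assignment, every fixed first index `ω₁ ∈ O_{h'}` and every coarse string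
`Ω^{(h)}_{L-1}`, `#{Ω^{(h')}_{L-1} ≺ Ω^{(h)}_{L-1} : χ(Ω^{(h')}_L) = 1} ≤ c^L γ^{(h-h')(L-3)/2}`.
The licensed fact F-011 (`LemmaA31` for BGM's INTERACTING family `ε_h`, Lemma 2.1) is NOT discharged by this theorem:
its residual content is the uniformity of `c` along that family (gap G-002 of the wave).
[cite: BenfattoGiulianiMastropietro2006, Lemma A3.1 p0036:L144; BenfattoGiulianiMastropietro2003, Lemma 3.1 (4.3) and §7.4 (4.3app)] -/
theorem LemmaA31_of_scaleIndependent {ε : (Fin 2 → ℝ) → ℝ} {μ e₀ : ℝ} {u : ℝ → ℝ → ℝ}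
    (hε : BGM2003.DispersionHyp ε μ e₀ u)
    (hshell : ∀ k : Fin 2 → ℝ, |ε k - μ| ≤ e₀ → ∃ θ e : ℝ, |e| ≤ e₀ ∧ k = BGM2003.levelPoint u θ e) :
    ∃ c : ℝ, 0 < c ∧ LemmaA31 4 e₀ μ (fun _ => ε) c := by
  obtain ⟨c, hc, hcount⟩ := BGM2003.lemma31_sectorCounting_holds ε μ e₀ u hε
  refine ⟨c, hc, ?_⟩
  intro h' h m hh' hh hm sgn ω₁ ωc hω₁ hωc
  have he₀ : 0 ≤ e₀ := hε.e₀_pos.le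
  have hanti := hε.antipodal
  -- tree scale indices `n = -h ≤ n' = -h'`
  set n : ℕ := scaleIdx h with hn_def
  set n' : ℕ := scaleIdx h' with hn'_def
  have hh'0 : h' ≤ 0 := hh'.trans hh
  have hn : n ≤ n' := by
    have h1 := natCast_scaleIdx hh; have h2 := natCast_scaleIdx hh'0
    omega
  have hac' : anisoCount h' = sectorCount n' := rfl
  have hac : anisoCount h = sectorCount n := rfl
  rw [hac'] at hω₁
  -- the half-turn index map (signs out), the normalised (all-`+`) fixed index and coarse string
  let hti : ℕ → Bool → ℕ → ℕ := fun N s j => if s then j else if j < 2 ^ N then j + 2 ^ N else j - 2 ^ N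
  let ω₁' : ℕ := hti n' (sgn 0) ω₁
  let ωt : Fin (m + 1) → ℕ := Fin.cons 0 fun i => hti n (sgn i.succ) (ωc i)
  have hω₁' : ω₁' < sectorCount n' := halfTurnIdx_lt _ hω₁
  have hωt : ∀ i, ωt i < sectorCount n := by
    refine Fin.cases ?_ (fun i => ?_)
    · exact sectorCount_pos n
    · simpa [ωt] using halfTurnIdx_lt (sgn i.succ) (by rw [← hac]; exact hωc i)
  obtain ⟨hL, -⟩ := hcount n n' hn
  have hbound := hL (m + 1) 0 ω₁' ωt (by omega) hω₁' hωt
  -- the counted set of BGM 2006 and its injection into the BGM 2003 string set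
  set A : Set (Fin m → ℕ) := {ω' : Fin m → ℕ | (∀ i, ω' i < anisoCount h') ∧ (∀ i, Refines h' h (ω' i) (ωc i)) ∧
      chi 4 e₀ μ (fun _ => ε) (fun i : Fin (m + 1) =>
        (⟨h', false, (Fin.cons ω₁ ω' : Fin (m + 1) → ℕ) i, sgn i⟩ : SectorLabel))} with hA_def
  set S := BGM2003.sectorStrings u e₀ n n' (m + 1) 0 ω₁' ωt with hS_def
  -- the map
  have hmemA : ∀ ω' ∈ A, ∀ i : Fin m, ω' i < sectorCount n' := fun ω' hω' i => hω'.1 i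
  let Φ : A → (Fin (m + 1) → Fin (sectorCount n')) := fun ω' =>
    Fin.cons ⟨ω₁', hω₁'⟩ fun i => ⟨hti n' (sgn i.succ) (ω'.1 i), halfTurnIdx_lt _ (hmemA ω'.1 ω'.2 i)⟩
  have hΦval : ∀ (ω' : A) (i : Fin (m + 1)),
      ((Φ ω' i : Fin (sectorCount n')) : ℕ) = hti n' (sgn i) ((Fin.cons ω₁ ω'.1 : Fin (m + 1) → ℕ) i) := by
    intro ω'
    refine Fin.cases ?_ (fun i => ?_)
    · simp [Φ, ω₁']
    · simp [Φ]
  -- Φ lands in S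
  have hΦmem : ∀ ω' : A, Φ ω' ∈ S := by
    intro ω'
    obtain ⟨hlt, href, k, hk, hsum⟩ := ω'.2
    refine ⟨by simp [Φ], ?_, ?_⟩
    · -- (i) nesting of the free legs
      intro i hi
      obtain ⟨j, rfl⟩ := Fin.exists_succ_eq.mpr hi
      have hr := (href j).2
      rw [hΦval]
      simp only [Fin.cons_succ, ωt]
      have hsub := sSector2003_subset_of_le u he₀ hn (hti n' (sgn j.succ) (ω'.1 j))
      rwa [halfTurnIdx_div hn _ (hlt j), hr] at hsub
    · -- (ii) the momenta, signs absorbed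
      refine ⟨fun i => if sgn i then k i else -k i, fun i => ?_, ?_⟩
      · rw [hΦval]
        have hki := hk i
        simp only [SectorLabel.toSet, Bool.false_eq_true, ↓reduceIte] at hki
        exact signedMom_mem_sSector2003 he₀ hanti (sgn i) (mem_sSector2003_of_mem_sSector hε hshell hh'0 hki)
      · exact hsum
  -- Φ is injective
  have hΦinj : Function.Injective (fun ω' : A => (⟨Φ ω', hΦmem ω'⟩ : S)) := by
    intro a b hab
    have hab' : Φ a = Φ b := congrArg Subtype.val hab
    apply Subtype.ext
    funext j
    have := congrArg (fun f => ((f j.succ : Fin (sectorCount n')) : ℕ)) hab'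
    simp only [Φ, Fin.cons_succ] at this
    exact halfTurnIdx_injOn _ (hmemA a.1 a.2 j) (hmemA b.1 b.2 j) this
  have hcard : A.ncard ≤ Nat.card S := by
    rw [← Nat.card_coe_set_eq]
    exact Nat.card_le_card_of_injective _ hΦinj
  -- exponents: `4^{(h-h')(L-3)/2} = 2^{(n'-n)(L-3)}`
  have hexp : (4 : ℝ) ^ (((h - h' : ℤ) : ℝ) * (((m + 1 : ℕ) : ℝ) - 3) / 2) =
      (2 : ℝ) ^ ((n' - n) * (m + 1 - 3)) := by
    have h1 := natCast_scaleIdx hh; have h2 := natCast_scaleIdx hh'0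
    have hhh : ((h - h' : ℤ) : ℝ) = ((n' - n : ℕ) : ℝ) := by
      rw [Nat.cast_sub hn]; push_cast; rw [← hn_def, ← hn'_def] at *
      have : (h : ℝ) - h' = (n' : ℝ) - n := by exact_mod_cast (show h - h' = (n' : ℤ) - n by omega)
      exact this
    have hm3 : (((m + 1 : ℕ) : ℝ) - 3) = ((m + 1 - 3 : ℕ) : ℝ) := by
      rw [Nat.cast_sub (by omega)]; push_cast; ring
    rw [hhh, hm3, show (4 : ℝ) = (2 : ℝ) ^ (2 : ℝ) by norm_num, ← Real.rpow_mul (by norm_num),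
      ← Real.rpow_natCast]
    congr 1
    push_cast
    ring
  calc ((A.ncard : ℕ) : ℝ) ≤ (Nat.card S : ℝ) := by exact_mod_cast hcard
    _ ≤ c ^ (m + 1) * (2 : ℝ) ^ ((n' - n) * (m + 1 - 3)) := hbound
    _ = c ^ (m + 1) * (4 : ℝ) ^ (((h - h' : ℤ) : ℝ) * (((m + 1 : ℕ) : ℝ) - 3) / 2) := by rw [hexp]

end BGM2006AppA

end Literature.MathematicalPhysics.QuantumLattice.FermiRG
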